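import Summits.BirchSwinnertonDyer.Rank1Residual.X1.LayerAlgebra
import Mathlib.LinearAlgebra.Matrix.Charpoly.Minpoly
import Mathlib.LinearAlgebra.Dimension.OrzechProperty
import Mathlib.RingTheory.FiniteType
import HarnessLib

/-!
# The layer norm of a linear factor: `N_n(T − r) = (−1)^{pⁿ+1} (1 + S − (1+r)^{pⁿ})`

B2B cell `bsd-rank1-residual`, unit `eisenstein-p1` GEN 18, FILE 16 (X1R0-GAPMAP §27; the
census column `mord₁` of the seven `M:paper` classes, `V76-LOCAL-TERM-PLAN.md` §3). HONEST FRAMING: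
research route; THEOREMS ONLY (no `def`, no named fact); pure commutative algebra of
`Λ = ℤ_p⟦T⟧`; nothing about any curve; nothing booked.

LEMMA M at layer `n` (FILE 15 `X1/GeneratorBoundOrdLayer`) bounds `ord_𝔪 N_n(f_E)`; the census
evaluates `ord_𝔪 N_n(D)` on candidate divisors `D` of the `p`-adic `L`-function, products of
ATOMS, most of them LINEAR `T − r`. This file computes the layer norm (FILE 13 `layerNorm`,
Mathlib `Algebra.norm` of `Λ` over `Λ_n = ℤ_p⟦ω_n⟧`) of a linear factor in closed form:

* §1 the POWER BASIS `1, U, …, U^{pⁿ−1}`, `U = 1 + T`, of `Λ` over `Λ_n` (`U^{pⁿ} = 1 + ω_n` lies in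
  `Λ_n`): it spans because `T^j = (U − 1)^j`, and `pⁿ` spanning vectors of a free module of rank
  `pⁿ` form a basis (Mathlib `basisOfTopLeSpanOfCardEqFinrank`, Orzech property of commutative
  rings); the minimal polynomial of `U` is `Y^{pⁿ} − (1 + S)` (Mathlib `PowerBasis.minpolyGen_eq`).
* §2 **`layerNorm_one_add_X_sub_layerHom`: `N_n(1 + T − a(ω_n)) = (−1)^{pⁿ} (a^{pⁿ} − (1 + S))`**
  for every `a ∈ Λ_n` (`det(M_U − a) = (−1)^{pⁿ} χ_U(a)`, `χ_U = minpoly`, Mathlib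
  `charpoly_leftMulMatrix`, `Matrix.eval_charpoly`); hence
  **`layerNorm_X_sub_C`: `N_n(T − r) = (−1)^{pⁿ} ((1+r)^{pⁿ} − 1 − S)`** for `r ∈ ℤ_p`, and for
  odd `p`: **`N_n(T − r) = S − ((1+r)^{pⁿ} − 1)`** — the census's `N(L)(T₁) = T₁ − ((1+r)^p − 1)`
  (so `ord_{𝔪} N_1(T − r) = min(v_p((1+r)^p − 1), 1)`).

## Sources
* L. Washington, GTM 83, §13.2 (`Λ` over `ℤ_p⟦ω_n⟧`). [Washington1997]
* N. Bourbaki, *Algebra* III §9 (norm = determinant of multiplication; characteristic polynomial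
  of a power basis) — Mathlib `Algebra.norm_eq_matrix_det`, `charpoly_leftMulMatrix`.
-/

noncomputable section

namespace Summit.BirchSwinnertonDyer.Rank1Residual.X1.LayerNormLinear

open PowerSeries Literature.NumberTheory.EllipticCurves
  Summit.BirchSwinnertonDyer.Rank1Residual.X1.LayerAlgebra Polynomial

variable (p : ℕ) [hp : Fact p.Prime] (n : ℕ)

/-! ## §1. The power basis `U^i`, `U = 1 + T` -/

/-- `T^j ∈ span_{Λ_n} {U^i : i < pⁿ}` for `j < pⁿ` (`T^j = (U − 1)^j`, binomial theorem). [folklore] -/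
theorem of_X_pow_mem_span (j : ℕ) (hj : j < p ^ n) :
    Layer.of p n (PowerSeries.X ^ j) ∈ Submodule.span (IwasawaAlgebra p)
      (Set.range fun i : Fin (p ^ n) => Layer.of p n ((1 + PowerSeries.X) ^ (i : ℕ))) := by
  have h : (PowerSeries.X : IwasawaAlgebra p) ^ j =
      ∑ i ∈ Finset.range (j + 1), (1 + PowerSeries.X) ^ i * (-1) ^ (j - i) * (j.choose i : IwasawaAlgebra p) := by
    rw [← add_pow]; ring
  rw [h, map_sum]
  refine Submodule.sum_mem _ fun i hi => ?_
  have hi' : i < p ^ n := lt_of_lt_of_le (Finset.mem_range.1 hi) hj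
  rw [mul_assoc, map_mul, mul_comm]
  have hl : layerHom p n ((-1) ^ (j - i) * (j.choose i : IwasawaAlgebra p)) =
      (-1) ^ (j - i) * (j.choose i : IwasawaAlgebra p) := by
    rw [map_mul, map_pow, map_neg, map_one, map_natCast]
  have hc : Layer.of p n ((-1) ^ (j - i) * (j.choose i : IwasawaAlgebra p)) =
      algebraMap (IwasawaAlgebra p) (Layer p n) ((-1) ^ (j - i) * (j.choose i : IwasawaAlgebra p)) := by
    rw [Layer.algebraMap_apply, hl]
  rw [hc, ← Algebra.smul_def]
  exact Submodule.smul_mem _ _ (Submodule.subset_span ⟨⟨i, hi'⟩, rfl⟩)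

/-- The powers `U^i`, `i < pⁿ`, span `Layer p n` over `Λ`. [folklore] -/
theorem top_le_span_pow :
    (⊤ : Submodule (IwasawaAlgebra p) (Layer p n)) ≤ Submodule.span (IwasawaAlgebra p)
      (Set.range fun i : Fin (p ^ n) => Layer.of p n ((1 + PowerSeries.X) ^ (i : ℕ))) := by
  rw [← (Layer.basis p n).span_eq, Submodule.span_le]
  rintro _ ⟨i, rfl⟩
  rw [Layer.basis_apply]
  exact of_X_pow_mem_span p n i i.2

/-- `U^{pⁿ} = 1 + ω_n ∈ Λ_n`: `of(1+T)^{pⁿ} = algebraMap (1 + S)`. [folklore] -/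
theorem of_one_add_X_pow :
    Layer.of p n (1 + PowerSeries.X) ^ p ^ n =
      algebraMap (IwasawaAlgebra p) (Layer p n) (1 + PowerSeries.X) := by
  rw [Layer.algebraMap_apply, ← map_pow]
  congr 1
  rw [map_add, map_one, layerHom_X, add_sub_cancel]

/-! ## §2. The norm of a linear factor -/

/-- **`N_n(U − a) = (−1)^{pⁿ} (a^{pⁿ} − (1 + S))`** for `U = 1 + T` and every `a` of the base
`Λ_n` (written in its variable `S`): the characteristic polynomial of multiplication by `U` in the
power basis `U^i` is its minimal polynomial `Y^{pⁿ} − (1 + S)`. [cite: Washington1997, §13.2] -/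
theorem layerNorm_one_add_X_sub_layerHom (a : IwasawaAlgebra p) :
    layerNorm p n (1 + PowerSeries.X - layerHom p n a) =
      (-1) ^ p ^ n * (a ^ p ^ n - (1 + PowerSeries.X)) := by
  classical
  -- the power basis
  let u : Fin (p ^ n) → Layer p n := fun i => Layer.of p n ((1 + PowerSeries.X) ^ (i : ℕ))
  have hcard : Fintype.card (Fin (p ^ n)) = Module.finrank (IwasawaAlgebra p) (Layer p n) := by
    rw [Fintype.card_fin, Layer.finrank_eq]
  let b : Module.Basis (Fin (p ^ n)) (IwasawaAlgebra p) (Layer p n) :=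
    basisOfTopLeSpanOfCardEqFinrank u (top_le_span_pow p n) hcard
  have hb : ∀ i, b i = Layer.of p n (1 + PowerSeries.X) ^ (i : ℕ) := fun i => by
    rw [coe_basisOfTopLeSpanOfCardEqFinrank, ← map_pow]
  let pb : PowerBasis (IwasawaAlgebra p) (Layer p n) :=
    { gen := Layer.of p n (1 + PowerSeries.X), dim := p ^ n, basis := b, basis_eq_pow := hb }
  have hN : 0 < p ^ n := pow_pos hp.out.pos n
  -- its minimal polynomial
  have hroot : Polynomial.aeval pb.gen
      (Polynomial.X ^ p ^ n - Polynomial.C (1 + PowerSeries.X) : (IwasawaAlgebra p)[X]) = 0 := by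
    rw [map_sub, map_pow, Polynomial.aeval_X, Polynomial.aeval_C]
    exact sub_eq_zero.2 (of_one_add_X_pow p n)
  have hmonic : (Polynomial.X ^ p ^ n - Polynomial.C (1 + PowerSeries.X) :
      (IwasawaAlgebra p)[X]).Monic :=
    Polynomial.monic_X_pow_sub_C _ hN.ne'
  have hmin : minpoly (IwasawaAlgebra p) pb.gen =
      Polynomial.X ^ p ^ n - Polynomial.C (1 + PowerSeries.X) := by
    rw [← PowerBasis.minpolyGen_eq]
    by_contra hne
    have hsub : pb.minpolyGen - (Polynomial.X ^ p ^ n - Polynomial.C (1 + PowerSeries.X)) ≠ 0 :=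
      sub_ne_zero.2 hne
    have hdeg : (pb.minpolyGen - (Polynomial.X ^ p ^ n - Polynomial.C (1 + PowerSeries.X))).degree <
        (pb.dim : WithBot ℕ) := by
      rw [← pb.degree_minpolyGen]
      refine Polynomial.degree_sub_lt ?_ pb.minpolyGen_monic.ne_zero ?_
      · rw [pb.degree_minpolyGen, Polynomial.degree_X_pow_sub_C hN]
      · rw [pb.minpolyGen_monic.leadingCoeff, hmonic.leadingCoeff]
    have hle := pb.dim_le_degree_of_root hsub (by rw [map_sub, pb.aeval_minpolyGen, hroot, sub_zero])
    exact absurd (lt_of_le_of_lt hle hdeg) (lt_irrefl _)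
  -- the characteristic polynomial of multiplication by `U`
  have hchar : (Algebra.leftMulMatrix b pb.gen).charpoly =
      Polynomial.X ^ p ^ n - Polynomial.C (1 + PowerSeries.X) := by
    rw [← hmin]
    exact charpoly_leftMulMatrix pb
  -- the norm as a determinant
  have hscalar : algebraMap (IwasawaAlgebra p) (Matrix (Fin (p ^ n)) (Fin (p ^ n)) (IwasawaAlgebra p)) a =
      Matrix.scalar (Fin (p ^ n)) a := by
    ext i j
    rw [Matrix.algebraMap_matrix_apply, Matrix.scalar_apply, Matrix.diagonal_apply]
    rfl
  have hof : Layer.of p n (1 + PowerSeries.X - layerHom p n a) =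
      pb.gen - algebraMap (IwasawaAlgebra p) (Layer p n) a := by
    rw [map_sub, Layer.algebraMap_apply]
  rw [layerNorm_apply, hof, Algebra.norm_eq_matrix_det b, map_sub, AlgHom.commutes, hscalar,
    ← neg_sub, Matrix.det_neg, Fintype.card_fin, ← Matrix.eval_charpoly, hchar]
  simp only [Polynomial.eval_sub, Polynomial.eval_pow, Polynomial.eval_X, Polynomial.eval_C]

/-- **`N_n(T − r) = (−1)^{pⁿ} ((1 + r)^{pⁿ} − 1 − S)`** for `r ∈ ℤ_p`. [cite: Washington1997, §13.2] -/
theorem layerNorm_X_sub_C (r : ℤ_[p]) :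
    layerNorm p n (PowerSeries.X - PowerSeries.C r) =
      (-1) ^ p ^ n * (PowerSeries.C ((1 + r) ^ p ^ n) - 1 - PowerSeries.X) := by
  have h := layerNorm_one_add_X_sub_layerHom p n (PowerSeries.C (1 + r))
  rw [layerHom_C, map_add, map_one, add_sub_add_left_eq_sub] at h
  rw [h, map_pow, map_add, map_one]
  ring

/-- **`N_n(T − r) = S − ((1 + r)^{pⁿ} − 1)` for ODD `p`** — the census's
`N(T − r)(T₁) = T₁ − ((1+r)^p − 1)`; so `ord_𝔪 N_n(T − r) = min(v_p((1+r)^{pⁿ} − 1), 1)`.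
[cite: Washington1997, §13.2] -/
theorem layerNorm_X_sub_C_of_odd (hodd : p ≠ 2) (r : ℤ_[p]) :
    layerNorm p n (PowerSeries.X - PowerSeries.C r) =
      PowerSeries.X - PowerSeries.C ((1 + r) ^ p ^ n - 1) := by
  have hpodd : Odd (p ^ n) := (hp.out.odd_of_ne_two hodd).pow
  rw [layerNorm_X_sub_C, hpodd.neg_one_pow, map_sub, map_one]
  ring

/-- The constant and linear coefficients of `N_n(T − r)` for odd `p`: `−((1+r)^{pⁿ} − 1)` and `1`;
all higher coefficients vanish. [folklore] -/
theorem coeff_layerNorm_X_sub_C_of_odd (hodd : p ≠ 2) (r : ℤ_[p]) :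
    PowerSeries.constantCoeff (layerNorm p n (PowerSeries.X - PowerSeries.C r)) =
        -((1 + r) ^ p ^ n - 1) ∧
      PowerSeries.coeff 1 (layerNorm p n (PowerSeries.X - PowerSeries.C r)) = 1 := by
  rw [layerNorm_X_sub_C_of_odd p n hodd]
  constructor
  · rw [map_sub, constantCoeff_X, constantCoeff_C, zero_sub]
  · rw [map_sub, coeff_one_X, PowerSeries.coeff_C, if_neg one_ne_zero, sub_zero]

end Summit.BirchSwinnertonDyer.Rank1Residual.X1.LayerNormLinear

end
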